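import Mathlib.Algebra.Homology.EulerCharacteristic
import Mathlib.Algebra.Homology.ShortComplex.ModuleCat
import Mathlib.LinearAlgebra.FiniteDimensional.Lemmas
import Mathlib.Data.Int.Interval
import HarnessLib

/-!
# The Euler–Poincaré formula: `χ(C) = χ(H(C))` for Mathlib's `HomologicalComplex.eulerChar`

Layer `Literature/Algebra/Homology` (pure linear algebra over Mathlib; proved theorems only, 0 definitions, 0 named
facts, no instances, no notation). Mathlib's `Mathlib.Algebra.Homology.EulerCharacteristic` (pin v4.32) DEFINES, for a
homological complex `C` of modules of any shape `c` carrying `ComplexShape.EulerCharSigns`,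
`HomologicalComplex.eulerChar C = ∑ᶠ i, χ(i) · finrank (C.X i)` and
`HomologicalComplex.homologyEulerChar C = ∑ᶠ i, χ(i) · finrank (C.homology i)`, together with the two
`finsum = Finset.sum` bookkeeping lemmas, but does not relate them. This file proves the **Euler–Poincaré principle**
(Hatcher, *Algebraic Topology*, Thm. 2.44: "`χ(X) = Σₙ (−1)ⁿ rank Hₙ(X)`", proved from
"`rank Cₙ = rank Zₙ + rank Bₙ₋₁`, `rank Zₙ = rank Bₙ + rank Hₙ`"; Lang, *Algebra*, XX §3, Thm. 3.1 "`χ(H(E)) = χ(E)`"):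

* `finrank_X₂_eq_finrank_homology_add` — for a short complex `X₁ ⟶ X₂ ⟶ X₃` of finite-dimensional vector spaces over a
  division ring, `dim X₂ = dim H + rk g + rk f` (two rank–nullity steps on Mathlib's `moduleCatHomologyIso`);
* `finrank_X_eq_finrank_homology_add` — degreewise, `dim Cⁱ = dim Hⁱ(C) + rk d(i, next i) + rk d(prev i, i)`;
* `finsum_χ_mul_finrank_range_d_prev_eq_neg` — the incoming boundary ranks, summed with signs, are MINUS the outgoing
  ones (pair `i ↔ c.next i` along `ComplexShape.EulerCharSigns.χ_next`; any shape, no finiteness needed);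
* **`eulerChar_eq_homologyEulerChar : C.eulerChar = C.homologyEulerChar`** for a complex of finite-dimensional spaces
  with finite `GradedObject.finrankSupport` — any complex shape with `EulerCharSigns`, any division ring;
* `eulerChar_eq_sum_homology` (the `Finset` form), `homologyEulerChar_eq_zero_of_exactAt` ∕ `eulerChar_eq_zero_of_exactAt`
  (an acyclic complex has `χ = 0`), and the `ℤ`-indexed cochain ∕ chain specialisations on `Finset.Icc a b` with the
  sign `Int.negOnePow` (`CochainComplex.sum_negOnePow_mul_finrank_eq`, `ChainComplex.sum_negOnePow_mul_finrank_eq`).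

NOT this statement (searched `lean search 'eulerChar'`, `'homologyEulerChar'`, `'Euler–Poincaré'`): the tree's
`Algebra/Homology/EulerCharacteristicAdditive` (additivity of `Σ_{q ≤ r} (−1)^q h^q` in a short exact sequence of
complexes, via the long exact sequence), `AlgebraicTopology/SingularHomology/EulerCharacteristicTriple` (relative
singular `χ`, long-exact-sequence bookkeeping) and `AlgebraicGeometry/KTheory/CoherentEulerCharHomology` (`χ = Σ (−1)ⁱ [Hⁱ]`
in `K₀(Coh X)`) are long-exact-sequence ∕ Grothendieck-group statements, none compares chains with homology for
`HomologicalComplex.eulerChar`; Mathlib has no such lemma (`homologyEulerChar` occurs only in its defining file).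

Library only (cell `pub-hodge-ring2`, count-neutral); proves nothing about any crux, route or conjecture. Mathlib API used:
`ShortComplex.moduleCatHomologyIso`, `LinearMap.finrank_range_add_finrank_ker`, `Submodule.finrank_quotient_add_finrank`,
`Submodule.equivMapOfInjective`, `finsum_mem_eq_of_bijOn`, `finsum_add_distrib`, `ComplexShape.next_eq'` ∕ `prev_eq'`;
`Mathlib.Data.Int.Interval` is imported only for `LocallyFiniteOrder ℤ` (`Finset.Icc` on `ℤ`).

## References

* A. Hatcher, *Algebraic Topology* (2002), Thm. 2.44 and its proof (p. 146–147). [HatcherAT2002]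
* S. Lang, *Algebra* (rev. 3rd ed., 2002), Ch. XX §3, Thm. 3.1 (Euler–Poincaré). [Lang2002]
-/

open CategoryTheory CategoryTheory.Limits

universe v u w

namespace Literature.Algebra.Homology

namespace EulerPoincare

variable {K : Type u} [DivisionRing K]

/-! ### One short complex: `dim X₂ = dim H + rk g + rk f` -/

/-- **Rank bookkeeping of a short complex** `X₁ —f→ X₂ —g→ X₃` of vector spaces with `X₂` finite-dimensional:
`dim X₂ = dim H + rk g + rk f`, where `H = ker g ⁄ im f` is Mathlib's `ShortComplex.homology`
("`rank Cₙ = rank Zₙ + rank Bₙ₋₁`, `rank Zₙ = rank Bₙ + rank Hₙ`"). [cite: HatcherAT2002, Thm. 2.44 (proof)] -/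
theorem finrank_X₂_eq_finrank_homology_add (S : ShortComplex (ModuleCat.{v} K)) [Module.Finite K S.X₂] :
    Module.finrank K S.X₂ = Module.finrank K S.homology + Module.finrank K (LinearMap.range S.g.hom) +
      Module.finrank K (LinearMap.range S.f.hom) := by
  have h1 := LinearMap.finrank_range_add_finrank_ker S.g.hom
  have h2 := Submodule.finrank_quotient_add_finrank (LinearMap.range S.moduleCatToCycles)
  have h3 : Module.finrank K S.homology =
      Module.finrank K (LinearMap.ker S.g.hom ⧸ LinearMap.range S.moduleCatToCycles) :=
    LinearEquiv.finrank_eq S.moduleCatHomologyIso.toLinearEquiv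
  have h4 : Module.finrank K (LinearMap.range S.moduleCatToCycles) = Module.finrank K (LinearMap.range S.f.hom) := by
    rw [LinearEquiv.finrank_eq (Submodule.equivMapOfInjective _ (LinearMap.ker S.g.hom).injective_subtype _),
      ← LinearMap.range_comp, LinearMap.subtype_comp_codRestrict]
  omega

/-! ### Degreewise: `dim Cⁱ = dim Hⁱ + rk dⁱ + rk dⁱ⁻¹` -/

variable {ι : Type w} {c : ComplexShape ι} (C : HomologicalComplex (ModuleCat.{v} K) c)

/-- **`dim Cⁱ = dim Hⁱ(C) + rk d(i, next i) + rk d(prev i, i)`** for a complex of any shape with `Cⁱ`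
finite-dimensional. [cite: HatcherAT2002, Thm. 2.44 (proof)] -/
theorem finrank_X_eq_finrank_homology_add (i : ι) [Module.Finite K (C.X i)] :
    Module.finrank K (C.X i) = Module.finrank K (C.homology i) +
      Module.finrank K (LinearMap.range (C.d i (c.next i)).hom) +
      Module.finrank K (LinearMap.range (C.d (c.prev i) i).hom) :=
  haveI : Module.Finite K (C.sc i).X₂ := inferInstanceAs (Module.Finite K (C.X i))
  finrank_X₂_eq_finrank_homology_add (C.sc i)

/-- `dim Hⁱ(C) ≤ dim Cⁱ`. [cite: HatcherAT2002, Thm. 2.44 (proof)] -/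
theorem finrank_homology_le (i : ι) [Module.Finite K (C.X i)] :
    Module.finrank K (C.homology i) ≤ Module.finrank K (C.X i) := by
  have := finrank_X_eq_finrank_homology_add C i
  omega

/-- The differential `d(i, j)` has rank `0` when `i`, `j` are not related by the shape. [cite: HatcherAT2002, Thm. 2.44 (proof)] -/
theorem finrank_range_d_eq_zero {i j : ι} (h : ¬c.Rel i j) :
    Module.finrank K (LinearMap.range (C.d i j).hom) = 0 := by
  rw [C.shape _ _ h, ModuleCat.hom_zero, LinearMap.range_zero, finrank_bot]

/-! ### The boundary ranks cancel in pairs `i ↔ next i` -/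

/-- **The signed incoming boundary ranks are minus the signed outgoing ones**:
`∑ᶠ i, χ(i) rk d(prev i, i) = − ∑ᶠ i, χ(i) rk d(i, next i)` — reindex along the bijection
`{i | Rel (prev i) i} → {j | Rel j (next j)}`, `i ↦ prev i`, and use `χ(next j) = −χ(j)`; no finiteness is needed
(both sides are `0` on infinite support). [cite: HatcherAT2002, Thm. 2.44 (proof)] [cite: Lang2002, XX §3 Thm. 3.1] -/
theorem finsum_χ_mul_finrank_range_d_prev_eq_neg [c.EulerCharSigns] :
    ∑ᶠ i, (c.χ i : ℤ) * (Module.finrank K (LinearMap.range (C.d (c.prev i) i).hom) : ℤ) =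
      -∑ᶠ i, (c.χ i : ℤ) * (Module.finrank K (LinearMap.range (C.d i (c.next i)).hom) : ℤ) := by
  set S : Set ι := {i | c.Rel (c.prev i) i} with hS
  set T : Set ι := {j | c.Rel j (c.next j)} with hT
  have hbij : Set.BijOn c.prev S T := by
    refine ⟨fun i hi => ?_, fun i hi i' hi' h => ?_, fun j hj => ?_⟩
    · show c.Rel (c.prev i) (c.next (c.prev i))
      rwa [c.next_eq' hi]
    · have h1 := c.next_eq' (show c.Rel (c.prev i) i from hi)
      have h2 := c.next_eq' (show c.Rel (c.prev i') i' from hi')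
      rw [← h1, ← h2, h]
    · refine ⟨c.next j, ?_, c.prev_eq' hj⟩
      show c.Rel (c.prev (c.next j)) (c.next j)
      rwa [c.prev_eq' hj]
  have lhs : ∑ᶠ i, (c.χ i : ℤ) * (Module.finrank K (LinearMap.range (C.d (c.prev i) i).hom) : ℤ) =
      ∑ᶠ i ∈ S, (c.χ i : ℤ) * (Module.finrank K (LinearMap.range (C.d (c.prev i) i).hom) : ℤ) := by
    rw [finsum_mem_def, Set.indicator_eq_self.2]
    intro i hi
    by_contra hi'
    exact hi (by simp only [finrank_range_d_eq_zero C hi', Nat.cast_zero, mul_zero])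
  have rhs : ∑ᶠ j, (c.χ j : ℤ) * (Module.finrank K (LinearMap.range (C.d j (c.next j)).hom) : ℤ) =
      ∑ᶠ j ∈ T, (c.χ j : ℤ) * (Module.finrank K (LinearMap.range (C.d j (c.next j)).hom) : ℤ) := by
    rw [finsum_mem_def, Set.indicator_eq_self.2]
    intro j hj
    by_contra hj'
    exact hj (by simp only [finrank_range_d_eq_zero C hj', Nat.cast_zero, mul_zero])
  rw [lhs, rhs, finsum_mem_eq_of_bijOn
    (g := fun j => -((c.χ j : ℤ) * (Module.finrank K (LinearMap.range (C.d j (c.next j)).hom) : ℤ)))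
    c.prev hbij ?_]
  · simp only [finsum_neg_distrib]
  · intro i hi
    have h1 : c.next (c.prev i) = i := c.next_eq' (show c.Rel (c.prev i) i from hi)
    have h2 : (c.χ (c.next (c.prev i)) : ℤ) = -(c.χ (c.prev i) : ℤ) := by
      rw [c.χ_next (show c.Rel (c.prev i) (c.next (c.prev i)) by rwa [h1]), Units.val_neg]
    rw [← neg_mul, ← h2]
    -- rewrite the remaining `next (prev i)` to `i`
    conv_rhs => rw [h1]

/-! ### The Euler–Poincaré formula -/

/-- The homology of a degreewise finite-dimensional complex with finite rank support has finite rank support.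
[cite: HatcherAT2002, Thm. 2.44] -/
theorem finrankSupport_homology_subset [∀ i, Module.Finite K (C.X i)] :
    GradedObject.finrankSupport (fun i => C.homology i) ⊆ GradedObject.finrankSupport C.X := by
  intro i hi
  have h := finrank_homology_le C i
  simp only [GradedObject.finrankSupport, Function.mem_support, ne_eq] at hi ⊢
  omega

section finiteness

variable [c.EulerCharSigns] [∀ i, Module.Finite K (C.X i)]

/-- The signed homology ranks have finite support if the complex has. [cite: HatcherAT2002, Thm. 2.44] -/
theorem hasFiniteSupport_χ_mul_finrank_homology (hC : (GradedObject.finrankSupport C.X).Finite) :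
    (fun i => (c.χ i : ℤ) * (Module.finrank K (C.homology i) : ℤ)).HasFiniteSupport := by
  refine hC.subset fun i hi => ?_
  have h := finrank_homology_le C i
  simp only [GradedObject.finrankSupport, Function.mem_support, ne_eq, mul_eq_zero, Units.ne_zero, Int.natCast_eq_zero,
    false_or] at hi ⊢
  omega

/-- The signed outgoing boundary ranks have finite support if the complex has. [cite: HatcherAT2002, Thm. 2.44] -/
theorem hasFiniteSupport_χ_mul_finrank_range_d_next (hC : (GradedObject.finrankSupport C.X).Finite) :
    (fun i => (c.χ i : ℤ) * (Module.finrank K (LinearMap.range (C.d i (c.next i)).hom) : ℤ)).HasFiniteSupport := by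
  refine hC.subset fun i hi => ?_
  have h := LinearMap.finrank_range_le (C.d i (c.next i)).hom
  simp only [GradedObject.finrankSupport, Function.mem_support, ne_eq, mul_eq_zero, Units.ne_zero, Int.natCast_eq_zero,
    false_or] at hi ⊢
  omega

/-- The signed incoming boundary ranks have finite support if the complex has. [cite: HatcherAT2002, Thm. 2.44] -/
theorem hasFiniteSupport_χ_mul_finrank_range_d_prev (hC : (GradedObject.finrankSupport C.X).Finite) :
    (fun i => (c.χ i : ℤ) * (Module.finrank K (LinearMap.range (C.d (c.prev i) i).hom) : ℤ)).HasFiniteSupport := by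
  refine hC.subset fun i hi => ?_
  have h := Submodule.finrank_le (LinearMap.range (C.d (c.prev i) i).hom)
  simp only [GradedObject.finrankSupport, Function.mem_support, ne_eq, mul_eq_zero, Units.ne_zero, Int.natCast_eq_zero,
    false_or] at hi ⊢
  omega

/-- **Euler–Poincaré formula** (Hatcher Thm. 2.44 "`χ(X) = Σₙ (−1)ⁿ rank Hₙ(X)`"; Lang XX Thm. 3.1
"`χ(H(E)) = χ(E)`"): for a homological complex `C` of finite-dimensional vector spaces over a division ring, of
any shape carrying `EulerCharSigns`, with only finitely many non-zero terms,
`∑ᶠ i, χ(i) dim Cⁱ = ∑ᶠ i, χ(i) dim Hⁱ(C)`, i.e. `C.eulerChar = C.homologyEulerChar` in Mathlib's vocabulary.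
[cite: HatcherAT2002, Thm. 2.44] [cite: Lang2002, XX §3 Thm. 3.1] -/
theorem eulerChar_eq_homologyEulerChar (hC : (GradedObject.finrankSupport C.X).Finite) :
    C.eulerChar = C.homologyEulerChar := by
  simp only [HomologicalComplex.eulerChar, HomologicalComplex.homologyEulerChar, GradedObject.eulerChar]
  have key : ∀ i, (c.χ i : ℤ) * (Module.finrank K (C.X i) : ℤ) =
      (c.χ i : ℤ) * (Module.finrank K (C.homology i) : ℤ) +
        ((c.χ i : ℤ) * (Module.finrank K (LinearMap.range (C.d i (c.next i)).hom) : ℤ) +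
          (c.χ i : ℤ) * (Module.finrank K (LinearMap.range (C.d (c.prev i) i).hom) : ℤ)) := by
    intro i
    rw [finrank_X_eq_finrank_homology_add C i]
    push_cast
    ring
  have hAB : (fun i => (c.χ i : ℤ) * (Module.finrank K (LinearMap.range (C.d i (c.next i)).hom) : ℤ) +
      (c.χ i : ℤ) * (Module.finrank K (LinearMap.range (C.d (c.prev i) i).hom) : ℤ)).HasFiniteSupport :=
    (hasFiniteSupport_χ_mul_finrank_range_d_next C hC).add (hasFiniteSupport_χ_mul_finrank_range_d_prev C hC)
  rw [finsum_congr key, finsum_add_distrib (hasFiniteSupport_χ_mul_finrank_homology C hC) hAB,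
    finsum_add_distrib (hasFiniteSupport_χ_mul_finrank_range_d_next C hC)
      (hasFiniteSupport_χ_mul_finrank_range_d_prev C hC),
    finsum_χ_mul_finrank_range_d_prev_eq_neg C, add_neg_cancel, add_zero]

/-- **Euler–Poincaré formula, `Finset` form**: if the non-zero terms of `C` have indices in `s`, then
`C.eulerChar = Σ_{i ∈ s} χ(i) dim Hⁱ(C)`. [cite: HatcherAT2002, Thm. 2.44] [cite: Lang2002, XX §3 Thm. 3.1] -/
theorem eulerChar_eq_sum_homology (s : Finset ι) (hC : GradedObject.finrankSupport C.X ⊆ s) :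
    C.eulerChar = ∑ i ∈ s, (c.χ i : ℤ) * (Module.finrank K (C.homology i) : ℤ) := by
  rw [eulerChar_eq_homologyEulerChar C (s.finite_toSet.subset hC)]
  exact C.homologyEulerChar_eq_sum_finSet_of_finrankSupport_subset s ((finrankSupport_homology_subset C).trans hC)

/-- `Σ_{i ∈ s} χ(i) dim Cⁱ = Σ_{i ∈ s} χ(i) dim Hⁱ(C)` whenever `s` contains the indices of the non-zero terms.
[cite: HatcherAT2002, Thm. 2.44] [cite: Lang2002, XX §3 Thm. 3.1] -/
theorem sum_χ_mul_finrank_X_eq_sum_χ_mul_finrank_homology (s : Finset ι) (hC : GradedObject.finrankSupport C.X ⊆ s) :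
    ∑ i ∈ s, (c.χ i : ℤ) * (Module.finrank K (C.X i) : ℤ) =
      ∑ i ∈ s, (c.χ i : ℤ) * (Module.finrank K (C.homology i) : ℤ) := by
  rw [← C.eulerChar_eq_sum_finSet_of_finrankSupport_subset s hC]
  exact eulerChar_eq_sum_homology C s hC

end finiteness

/-! ### Acyclic complexes -/

/-- The homological Euler characteristic of an acyclic complex is `0`. [cite: Lang2002, XX §3 Thm. 3.1] -/
theorem homologyEulerChar_eq_zero_of_exactAt [c.EulerCharSigns] (h : ∀ i, C.ExactAt i) : C.homologyEulerChar = 0 := by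
  simp only [HomologicalComplex.homologyEulerChar, GradedObject.eulerChar]
  refine finsum_eq_zero_of_forall_eq_zero fun i => ?_
  haveI := ModuleCat.subsingleton_of_isZero ((C.exactAt_iff_isZero_homology i).1 (h i))
  rw [Module.finrank_zero_of_subsingleton, Nat.cast_zero, mul_zero]

/-- **An acyclic complex of finite-dimensional spaces with finitely many non-zero terms has Euler characteristic
`0`**: `∑ᶠ i, χ(i) dim Cⁱ = 0`. [cite: Lang2002, XX §3 Thm. 3.1] [cite: HatcherAT2002, Thm. 2.44] -/
theorem eulerChar_eq_zero_of_exactAt [c.EulerCharSigns] [∀ i, Module.Finite K (C.X i)]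
    (hC : (GradedObject.finrankSupport C.X).Finite) (h : ∀ i, C.ExactAt i) : C.eulerChar = 0 := by
  rw [eulerChar_eq_homologyEulerChar C hC, homologyEulerChar_eq_zero_of_exactAt C h]

end EulerPoincare

/-! ### `ℤ`-indexed cochain and chain complexes -/

/-- **Euler–Poincaré for a bounded cochain complex of finite-dimensional spaces**: if `Cⁿ = 0` outside `[a, b]`,
`Σ_{n=a}^{b} (−1)ⁿ dim Cⁿ = Σ_{n=a}^{b} (−1)ⁿ dim Hⁿ(C)`. [cite: HatcherAT2002, Thm. 2.44] [cite: Lang2002, XX §3 Thm. 3.1] -/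
theorem CochainComplex.sum_negOnePow_mul_finrank_eq {K : Type u} [DivisionRing K]
    (C : CochainComplex (ModuleCat.{v} K) ℤ) [∀ n, Module.Finite K (C.X n)] (a b : ℤ)
    (hC : ∀ n, n ∉ Finset.Icc a b → IsZero (C.X n)) :
    ∑ n ∈ Finset.Icc a b, (n.negOnePow : ℤ) * (Module.finrank K (C.X n) : ℤ) =
      ∑ n ∈ Finset.Icc a b, (n.negOnePow : ℤ) * (Module.finrank K (C.homology n) : ℤ) := by
  have hsupp : GradedObject.finrankSupport C.X ⊆ (Finset.Icc a b : Finset ℤ) := by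
    intro n hn
    by_contra hn'
    haveI := ModuleCat.subsingleton_of_isZero (hC n hn')
    exact hn (Module.finrank_zero_of_subsingleton)
  simpa using EulerPoincare.sum_χ_mul_finrank_X_eq_sum_χ_mul_finrank_homology C (Finset.Icc a b) hsupp

/-- **Euler–Poincaré for a bounded chain complex of finite-dimensional spaces**: if `Cₙ = 0` outside `[a, b]`,
`Σ_{n=a}^{b} (−1)ⁿ dim Cₙ = Σ_{n=a}^{b} (−1)ⁿ dim Hₙ(C)`. [cite: HatcherAT2002, Thm. 2.44] [cite: Lang2002, XX §3 Thm. 3.1] -/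
theorem ChainComplex.sum_negOnePow_mul_finrank_eq {K : Type u} [DivisionRing K]
    (C : ChainComplex (ModuleCat.{v} K) ℤ) [∀ n, Module.Finite K (C.X n)] (a b : ℤ)
    (hC : ∀ n, n ∉ Finset.Icc a b → IsZero (C.X n)) :
    ∑ n ∈ Finset.Icc a b, (n.negOnePow : ℤ) * (Module.finrank K (C.X n) : ℤ) =
      ∑ n ∈ Finset.Icc a b, (n.negOnePow : ℤ) * (Module.finrank K (C.homology n) : ℤ) := by
  have hsupp : GradedObject.finrankSupport C.X ⊆ (Finset.Icc a b : Finset ℤ) := by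
    intro n hn
    by_contra hn'
    haveI := ModuleCat.subsingleton_of_isZero (hC n hn')
    exact hn (Module.finrank_zero_of_subsingleton)
  simpa using EulerPoincare.sum_χ_mul_finrank_X_eq_sum_χ_mul_finrank_homology C (Finset.Icc a b) hsupp

end Literature.Algebra.Homology
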